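import Summits.ResolutionOfSingularities.ResolutionOfSingularities.Theorems.HomologicalConductorNoZenoRFirstKindAssembly
import Summits.ResolutionOfSingularities.ResolutionOfSingularities.Theorems.HomologicalConductorNoZenoRFactorStepFibre
import Summits.ResolutionOfSingularities.ResolutionOfSingularities.Theorems.HomologicalConductorNoZenoRSurfacePrincipalization
import Literature.AlgebraicGeometry.Resolution.QuasiProjectiveResolution
import Literature.AlgebraicGeometry.Resolution.EmbeddedCurvePointBlowups
import Literature.AlgebraicGeometry.Resolution.PointCentrePermissible
import Literature.AlgebraicGeometry.Resolution.RegularBlowup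
import Literature.AlgebraicGeometry.Resolution.BlowupsProperProofs
import Literature.AlgebraicGeometry.Resolution.BlowupsIntegral
import Literature.AlgebraicGeometry.Resolution.BlowupsExistence
import HarnessLib

/-!
# Crux `NoZenoR` (stmt-ResolutionOfSingularities-19943) — the first-kind clause (F): the blow-up stage and the
# reduction of the one-step descent to the NON-ISOMORPHISM LOCUS statement

Route `ResolutionOfSingularities/HomologicalConductor` (cell decomp-res, hand leafhand-res-homologicalconduct-16 g3).
OURS: AI-written bookkeeping over tree theorems, weaker than expert review; nothing here is a statement of the
manuscript under review (Hironaka 2017).  SUPPORT level, counted 0.  Def-free, no new named facts.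

Sequel of `…NoZenoRFirstKindAssembly` (`firstKindClause_of_step`: (F) modulo the one-step descent `hstep`).  Here
`hstep` is reduced to the purely local statement (N) «a non-isomorphic `S`-morphism `h : X → Y` of desingularizations
has a closed point `y ∈ Y` with `dim 𝒪_{Y,y} = 2` over which NO stalk map `𝒪_{Y,y} → 𝒪_{X,x}` is surjective and
`𝓘_{y}·𝒪_X ≠ 0`» (sibling hand 18 g1, `…NoZenoRNonIsoLocus`):

* `ringKrullDim_stalk_le_two` — local rings of a desingularization of a two-dimensional Noetherian local domain
  have dimension `≤ 2`;
* `isResolution_blowup_point_comp` — the BLOW-UP STAGE: blowing up a closed point `y` (`dim 𝒪_{Y,y} = 2`) of a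
  desingularization `g : Y → Spec S` gives a desingularization `b ≫ g` (tree: blow-ups of locally Noetherian schemes
  are proper, blow-ups of integral schemes along non-zero ideals are integral and birational, blow-ups of regular
  schemes along regular centres are regular);
* `step_of_nonIso` — (N) ⇒ `hstep`, through hand 18 g1's FactorStep′
  (`Lipman12B.exists_fac_blowup_point_of_forall_not_surjective'`, Stacks 0C5H) and `exists_isBlowup`;
* `firstKindClause_of_nonIso` — **(F) ⟸ (N)**.

No crux or summit statement is proved here.
-/

noncomputable section

-- single-problem summit: the doubled namespace component `ResolutionOfSingularities` is forced
set_option linter.dupNamespace false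

open CategoryTheory AlgebraicGeometry TopologicalSpace Topology IsLocalRing
open Literature.AlgebraicGeometry.Resolution Scheme.IdealSheafData

namespace Summit.ResolutionOfSingularities.ResolutionOfSingularities.Theorems.NoZeno.ExcCount.FirstKind

variable {S : Type} [CommRing S] [IsNoetherianRing S] [IsDomain S]

/-! ## Local rings of a desingularization have dimension `≤ 2` -/

omit [IsDomain S] in
/-- **`dim 𝒪_{X,x} ≤ 2` on a desingularization of a two-dimensional Noetherian local domain** (`dim 𝒪_{X,x} =
coheight x ≤ height x + coheight x ≤ dim X ≤ 2`). [cite: EGAIV2, 5.6.5.1] -/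
theorem ringKrullDim_stalk_le_two (h2 : ringKrullDim S = 2) {X : Scheme.{0}} {π : X ⟶ Spec (.of S)}
    (hπ : IsResolution π) (x : X) : ringKrullDim (X.presheaf.stalk x) ≤ 2 := by
  have h := hπ.height_add_coheight_le_two h2.le x
  have hco : Order.coheight x ≤ 2 := le_trans (by simp) h
  rw [ringKrullDim_stalk_eq_coheight x]
  exact (WithBot.coe_le_coe.mpr hco : ((Order.coheight x : ℕ∞) : WithBot ℕ∞) ≤ ((2 : ℕ∞) : WithBot ℕ∞))

/-! ## The blow-up stage -/

/-- **The blow-up stage: blowing up a closed point of a desingularization gives a desingularization.**  For `S` a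
Noetherian local domain, `g : Y → Spec S` a desingularization, `y ∈ Y` closed with `dim 𝒪_{Y,y} = 2` and
`b : Y₁ → Y` a blowing up of `𝓘_{y}` (reduced point): `b ≫ g` is a desingularization — `b` is proper
(`IsBlowup.isProper`), `Y₁` is integral and `b` birational (`IsBlowup.isIntegral`, `IsBlowup.isBirational'`; the
centre ideal is non-zero because `y` is not the generic point), and `Y₁` is regular (`IsBlowup.isRegular_of_isRegular_subscheme`
with the regular centre `isRegular_subscheme_vanishingIdeal_singleton`).
[cite: Liu2002, Thm. 8.1.19 (a)]; [cite: StacksProject, Tag 02ND] -/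
theorem isResolution_blowup_point_comp {Y : Scheme.{0}} (g : Y ⟶ Spec (.of S)) (hg : IsResolution g)
    {y : Y} (hy : IsClosed ({y} : Set Y)) (hy2 : ringKrullDim (Y.presheaf.stalk y) = 2)
    {Y₁ : Scheme.{0}} (b : Y₁ ⟶ Y) (hb : IsBlowup b (vanishingIdeal ⟨{y}, hy⟩)) :
    IsResolution (b ≫ g) := by
  haveI : IsIntegral Y := hg.isIntegral_source
  haveI : IsProper g := hg.isProper
  haveI : IsLocallyNoetherian Y := LocallyOfFiniteType.isLocallyNoetherian g
  -- `y` is not the generic point: `dim 𝒪_{Y,y} = coheight y` would be `0`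
  have hyne : ({y} : Set Y) ≠ Set.univ := by
    intro h
    have hmax : IsMax y := fun z _ => by
      have hz : z ∈ ({y} : Set Y) := h ▸ Set.mem_univ z
      rw [Set.mem_singleton_iff] at hz
      exact le_of_eq hz
    have h0 : ringKrullDim (Y.presheaf.stalk y) = 0 := by
      rw [ringKrullDim_stalk_eq_coheight y, Order.coheight_eq_zero.mpr hmax]
      exact WithBot.coe_zero
    rw [hy2] at h0
    exact absurd h0 (by decide)
  have hJ : vanishingIdeal (⟨{y}, hy⟩ : Closeds Y) ≠ ⊥ := vanishingIdeal_singleton_ne_bot hy hyne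
  haveI : IsIntegral Y₁ := hb.isIntegral hJ
  haveI : IsProper b := hb.isProper
  have hreg : Scheme.IsRegular Y₁ :=
    hb.isRegular_of_isRegular_subscheme hg.isRegular (isRegular_subscheme_vanishingIdeal_singleton hy)
  exact ⟨inferInstance, (hb.isBirational' hJ).comp hg.isBirational, hreg⟩

/-! ## The one-step descent from the non-isomorphism locus statement -/

/-- **The one-step descent `hstep` of `firstKindClause_of_step` from the non-isomorphism-locus statement (N).**
Given, for every non-isomorphic `S`-morphism `h : X → Y` to a desingularization, a closed point `y ∈ Y` with
`dim 𝒪_{Y,y} = 2`, NO surjective stalk map `𝒪_{Y,y} → 𝒪_{X,x}` over `y`, and `𝓘_{y}·𝒪_X ≠ 0`: then `h` factors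
through the blowing up `b : Y₁ → Y` of `y` (FactorStep′: `𝓘_{y}·𝒪_X` is invertible — Abhyankar's key lemma at the
two-dimensional points over `y`, trivially at the one-dimensional ones — and the universal property of blowing up;
`exists_isBlowup`), and `b ≫ g` is a desingularization (`isResolution_blowup_point_comp`).
[cite: StacksProject, Tag 0C5H]; [cite: HunekeSwanson2006, Thm. 14.5.2] -/
theorem step_of_nonIso (h2 : ringKrullDim S = 2) {X : Scheme.{0}} {π : X ⟶ Spec (.of S)}
    (hπ : IsResolution π)
    (hN : ∀ (Y : Scheme.{0}) (g : Y ⟶ Spec (.of S)) (h : X ⟶ Y), IsResolution g → h ≫ g = π → ¬ IsIso h →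
      ∃ (y : Y) (hy : IsClosed ({y} : Set Y)), ringKrullDim (Y.presheaf.stalk y) = 2 ∧
        (∀ x : X, h.base x = y → ¬ Function.Surjective (h.stalkMap x)) ∧
        (vanishingIdeal ⟨{y}, hy⟩).comap h ≠ ⊥) :
    ∀ (Y : Scheme.{0}) (g : Y ⟶ Spec (.of S)) (h : X ⟶ Y), IsResolution g → h ≫ g = π → ¬ IsIso h →
      ∃ (y : Y) (hy : IsClosed ({y} : Set Y)), ringKrullDim (Y.presheaf.stalk y) = 2 ∧
        ∃ (Y₁ : Scheme.{0}) (b : Y₁ ⟶ Y) (h₁ : X ⟶ Y₁),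
          IsBlowup b (vanishingIdeal ⟨{y}, hy⟩) ∧ h₁ ≫ b = h ∧ IsResolution (b ≫ g) := by
  intro Y g h hg hh hne
  obtain ⟨y, hy, hy2, hns, hbot⟩ := hN Y g h hg hh hne
  haveI : IsIntegral X := hπ.isIntegral_source
  haveI : IsIntegral Y := hg.isIntegral_source
  haveI : IsProper π := hπ.isProper
  haveI : IsLocallyNoetherian X := LocallyOfFiniteType.isLocallyNoetherian π
  haveI : IsRegularLocalRing (Y.presheaf.stalk y) := hg.isRegular y
  have hres : IsResolution (h ≫ g) := by rw [hh]; exact hπ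
  obtain ⟨-, hbir⟩ := isProper_and_isBirational_of_comp g h hres hg
  haveI : IsDominant h := hbir.isDominant
  have hX : ∀ x : X, h.base x = y →
      IsRegularLocalRing (X.presheaf.stalk x) ∧ ringKrullDim (X.presheaf.stalk x) ≤ 2 :=
    fun x _ => ⟨hπ.isRegular x, ringKrullDim_stalk_le_two h2 hπ x⟩
  obtain ⟨Y₁, b, hb⟩ := exists_isBlowup Y (vanishingIdeal ⟨{y}, hy⟩)
  obtain ⟨h₁, hh₁⟩ :=
    Lipman12B.exists_fac_blowup_point_of_forall_not_surjective' h hbir hy hy2 hX hns hbot hb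
  exact ⟨y, hy, hy2, Y₁, b, h₁, hb, hh₁, isResolution_blowup_point_comp g hg hy hy2 b hb⟩

/-- **The first-kind clause (F) of Lipman (27.3)/(4.1) ⟸ the non-isomorphism-locus statement (N).**  For a
desingularization `π : X → Spec S` of a Noetherian local domain of Krull dimension `2`: if every non-isomorphic
`S`-morphism `h : X → Y` to a desingularization admits a closed `y ∈ Y` with `dim 𝒪_{Y,y} = 2`, no surjective stalk
map over `y` and `𝓘_{y}·𝒪_X ≠ 0` (N), then every such `h` forces an integral exceptional curve OF THE FIRST KIND on `X`
— the literal binder `hF` of `…NoZenoRCriterionM.isMinimalResolution_iff_criterionM_of_27_1_4_1`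
(`firstKindClause_of_step` + `step_of_nonIso`). [cite: Lipman1969, Corollary (27.3), proof (p. 277)];
[cite: StacksProject, Tag 0C5R] -/
theorem firstKindClause_of_nonIso [IsLocalRing S] (h2 : ringKrullDim S = 2) {X : Scheme.{0}}
    {π : X ⟶ Spec (.of S)}
    (hπ : IsResolution π)
    (hN : ∀ (Y : Scheme.{0}) (g : Y ⟶ Spec (.of S)) (h : X ⟶ Y), IsResolution g → h ≫ g = π → ¬ IsIso h →
      ∃ (y : Y) (hy : IsClosed ({y} : Set Y)), ringKrullDim (Y.presheaf.stalk y) = 2 ∧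
        (∀ x : X, h.base x = y → ¬ Function.Surjective (h.stalkMap x)) ∧
        (vanishingIdeal ⟨{y}, hy⟩).comap h ≠ ⊥) :
    ∀ (Y : Scheme.{0}) (g : Y ⟶ Spec (.of S)) (h : X ⟶ Y), IsResolution g → h ≫ g = π → ¬ IsIso h →
      ∃ η ∈ excCurvePoints π, h0 π (primeDivisorIdeal η ^ 2) = 3 * h0 π (primeDivisorIdeal η) :=
  firstKindClause_of_step h2 hπ (step_of_nonIso h2 hπ hN)

end Summit.ResolutionOfSingularities.ResolutionOfSingularities.Theorems.NoZeno.ExcCount.FirstKind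

end
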